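import Literature.AlgebraicGeometry.Frobenioids.BaseFrobeniusSections
import Mathlib.CategoryTheory.IsConnected
import HarnessLib

/-!
# Frobenioids I, Definition 2.7 (ii) and Remark 2.7.2: base-sections and Frobenius-sections

Mochizuki, *The geometry of Frobenioids I: the general theory*, Kyushu J. Math. **62** (2008)
293–400, §2, Definition 2.7 (ii) p.51 and Remark 2.7.2 p.52
[cite: MochizukiFrdI2008, Def. 2.7(ii) p.51] [cite: MochizukiFrdI2008, Rem. 2.7.2 p.52].

Three named statements of `BaseFrobeniusSections.lean` are proved:
* `endDegFrIndependent` (Def. 2.7 (ii), "since `P` is connected, `deg_Fr(ε_A)` is independent of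
  `A`"): arrows of `P` are linear, so `deg_Fr` of the components of `ε ∈ End(P ↪ C)` is constant
  along arrows, and `P ≃ D` is connected;
* `distinguishedBothIffId` (Rmk. 2.7.2, first claim): a `P`-distinguished arrow is linear, an
  `F`-distinguished one `F(n)_A` has Frobenius degree `n`, so `n = 1` and `F(1) = id`;
* `distinguishedFactorization` (Rmk. 2.7.2, second claim): for `C` a skeleton of base-trivial type
  every object lies in `P` (`P → D` is essentially surjective), `Base(φ)` lifts to a unique
  `P`-distinguished `α : A → B`, `φ = ψ ; α` for a unique base-identity `ψ` (universal property of
  the pull-back morphism `α`), and `ψ = F(n)_A ; β` with `n := deg_Fr(ψ)` and `β` a base-identity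
  pre-step (Def. 1.3 (iv)(a), (ii)); uniqueness "in the strict sense" from the faithfulness of
  `P → D`, the universal property of `α`, and total epimorphicity.
-/

namespace Literature.AlgebraicGeometry.Frobenioids

open CategoryTheory Opposite

universe w v v' u u'

namespace PreFrobenioid

variable {D : Type u} [Category.{v} D] {Φ : Dᵒᵖ ⥤ CommMonCat.{w}}
  {C : Type u'} [Category.{v'} C] {F : C ⥤ ElemFrobenioid Φ}

/-! ### Definition 2.7 (ii): `deg_Fr(ε_A)` is independent of `A` -/

/-- Along an arrow `f : A → B` of a base-section `P` (a pull-back morphism, hence linear) the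
Frobenius degrees of the components of `ε ∈ End(P ↪ C)` agree (`f ; ε_B = ε_A ; f`).
[cite: MochizukiFrdI2008, Def. 2.7(ii) p.51] -/
theorem degFr_app_eq_of_hom (hF : IsFrobenioid F) {P : Presection C} (hP : IsBaseSection F P)
    (ε : End P.ι) {A B : P.Cat} (f : A ⟶ B) : degFr F (ε.app A) = degFr F (ε.app B) := by
  have hlin : degFr F (P.ι.map f) = 1 := (hF.iv_b (P.ι.map f) (hP.hom_pullback f.1 f.2)).2
  have h := congrArg (degFr F) (ε.naturality f)
  rw [degFr_comp, degFr_comp, hlin, one_mul, mul_one] at h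
  exact h.symm

/-- A base-section is a connected category (`P → D` is an equivalence and `D` is connected).
[cite: MochizukiFrdI2008, Def. 2.7(ii) p.51] -/
theorem isConnected_of_isBaseSection (hF : IsFrobenioid F) {P : Presection C} (hP : IsBaseSection F P) :
    IsConnected P.Cat := by
  haveI : IsConnected D :=
    isGraphConnected_iff_isConnected.mp hF.isPreFrobenioid.isGraphConnected_base
  haveI := hP.isEquivalence
  exact isConnected_of_equivalent (P.toBase F).asEquivalence.symm

/-- **Def. 2.7 (ii)**, preliminary claim: `deg_Fr(ε_A)` is independent of `A ∈ Ob(P)` — the named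
statement `EndDegFrIndependent F P`. [cite: MochizukiFrdI2008, Def. 2.7(ii) p.51] -/
theorem endDegFrIndependent (P : Presection C) : EndDegFrIndependent F P := by
  intro hF hP ε A B
  haveI := isConnected_of_isBaseSection hF hP
  exact constant_of_preserves_morphisms (fun X : P.Cat => degFr F (ε.app X))
    (fun _ _ f => degFr_app_eq_of_hom hF hP ε f) A B

/-! ### Remark 2.7.2, first claim -/

/-- Components of `F(1)` are identities. [cite: MochizukiFrdI2008, Def. 2.7(ii) p.51] -/
theorem frobeniusSection_one_app {P : Presection C} (Fr : ℕ+ →* End P.ι) (A : P.Cat) :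
    (Fr 1).app A = 𝟙 A.1 := by
  rw [map_one]; rfl

/-- **Rmk. 2.7.2**, first claim: "the only arrows of `C` which are both `F`- and `P`-distinguished
are the identity arrows" — the named statement `DistinguishedBothIffId F P Fr`.
[cite: MochizukiFrdI2008, Rem. 2.7.2 p.52] -/
theorem distinguishedBothIffId (P : Presection C) (Fr : ℕ+ →* End P.ι) : DistinguishedBothIffId F P Fr := by
  intro hF _ hpair A φ hφP hφF
  obtain ⟨hA, n, hn⟩ := hφF
  have hlin : degFr F φ = 1 := (hF.iv_b φ (hpair.isBaseSection.hom_pullback φ hφP)).2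
  have hdeg : degFr F ((Fr n).app ⟨A, hA⟩) = n := hpair.isFrobeniusSection.degFr_eq n ⟨A, hA⟩
  have h2 : degFr F φ = n := hn ▸ hdeg
  have hn1 : n = 1 := h2.symm.trans hlin
  subst hn1
  rw [← hn]
  exact frobeniusSection_one_app Fr ⟨A, hA⟩

/-! ### Remark 2.7.2, second claim -/

/-- In a skeleton of base-trivial type every object lies in the base-section (`P → D` is
essentially surjective). [cite: MochizukiFrdI2008, Rem. 2.7.2 p.52] -/
theorem obj_of_skeletal {P : Presection C} (hP : IsBaseSection F P) (hbt : IsOfType (IsBaseTrivial F))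
    (hsk : Skeletal C) (X : C) : P.obj X := by
  haveI := hP.isEquivalence
  let Y := (P.toBase F).objPreimage (baseObj F X)
  obtain ⟨e⟩ := hbt X Y.1 ⟨((P.toBase F).objObjPreimageIso (baseObj F X)).symm⟩
  have hYX : Y.1 = X := hsk ⟨e⟩
  exact hYX ▸ Y.2

/-- An `F`-distinguished endomorphism is a base-identity endomorphism of Frobenius type; its degree
identifies it. [cite: MochizukiFrdI2008, Def. 2.7(ii) p.51] -/
theorem IsFDistinguished.eq_app {P : Presection C} {Fr : ℕ+ →* End P.ι} (hFr : IsFrobeniusSection F P Fr)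
    {A : C} {γ : A ⟶ A} (hγ : IsFDistinguished P Fr γ) (hA : P.obj A) :
    γ = (Fr (degFr F γ)).app ⟨A, hA⟩ ∧ IsBaseIdentity F γ := by
  obtain ⟨hA', n, rfl⟩ := hγ
  exact ⟨(congrArg (fun m => (Fr m).app (⟨A, hA⟩ : P.Cat)) (hFr.degFr_eq n ⟨A, hA'⟩)).symm,
    hFr.isBaseIdentity n ⟨A, hA'⟩⟩

/-- **Rmk. 2.7.2**, second claim: for `C` a skeleton of base-trivial (and isotropic) type with a
base-Frobenius pair `(P, F)`, every `φ : A → B` factors uniquely as `φ = γ ; β ; α` (printed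
`α ∘ β ∘ γ`) with `γ` `F`-distinguished, `β` a base-identity pre-step and `α` `P`-distinguished — the
named statement `DistinguishedFactorization F P Fr`. [cite: MochizukiFrdI2008, Rem. 2.7.2 p.52] -/
theorem distinguishedFactorization (P : Presection C) (Fr : ℕ+ →* End P.ι) :
    DistinguishedFactorization F P Fr := by
  intro hF _ hpair hbt hsk A B φ
  have hPF := hF.isPreFrobenioid
  have hP := hpair.isBaseSection
  have hFr := hpair.isFrobeniusSection
  haveI := hP.isEquivalence
  have hA : P.obj A := obj_of_skeletal hP hbt hsk A
  have hB : P.obj B := obj_of_skeletal hP hbt hsk B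
  -- `α`: the `P`-distinguished lift of `Base(φ)`
  let A' : P.Cat := ⟨A, hA⟩
  let B' : P.Cat := ⟨B, hB⟩
  let α : A' ⟶ B' := (P.toBase F).preimage (X := A') (Y := B') (Base F φ)
  have hαb : Base F α.1 = Base F φ := (P.toBase F).map_preimage (X := A') (Y := B') (Base F φ)
  have hαpb : IsPullbackMorphism F α.1 := hP.hom_pullback α.1 α.2
  -- `φ = ψ ; α` with `ψ` base-identity
  obtain ⟨ψ, hψ'⟩ := (hαpb A).2 ⟨(φ, 𝟙 _), by rw [hαb, Category.id_comp]⟩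
  have hψ : ψ ≫ α.1 = φ := congrArg (fun p : PullbackHomData F α.1 A => p.1.1) hψ'
  have hψb : Base F ψ = 𝟙 _ := congrArg (fun p : PullbackHomData F α.1 A => p.1.2) hψ'
  -- `ψ = F(n)_A ; β`
  set n := degFr F ψ with hn
  obtain ⟨X, Y, γ', β', α', hfac, hγ', hβ', hα'⟩ := hF.iv_a_exists ψ
  have hdeg : degFr F γ' = n := by
    rw [hn, ← hfac, degFr_comp, degFr_comp, hβ'.1, (hF.iv_b α' hα').2, one_mul, mul_one]
  let γ : A ⟶ A := (Fr n).app ⟨A, hA⟩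
  obtain ⟨e, he⟩ := hF.ii_unique γ' γ hγ' (hFr.isFrobeniusType n ⟨A, hA⟩)
    (hdeg.trans (hFr.degFr_eq n ⟨A, hA⟩).symm)
  let β : A ⟶ A := e.inv ≫ β' ≫ α'
  have hγβ : γ ≫ β = ψ := by
    show γ ≫ e.inv ≫ β' ≫ α' = ψ
    rw [← he, Category.assoc, e.hom_inv_id_assoc, hfac]
  have hβb : IsBaseIdentity F β := by
    have h := congrArg (Base F) hγβ
    rw [base_comp, show Base F γ = 𝟙 _ from hFr.isBaseIdentity n ⟨A, hA⟩, Category.id_comp, hψb] at h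
    exact h
  have hβpre : IsPreStep F β := by
    refine ⟨?_, by rw [show IsBaseIso F β ↔ IsIso (Base F β) from Iff.rfl, hβb]; infer_instance⟩
    show degFr F (e.inv ≫ β' ≫ α') = 1
    rw [degFr_comp, degFr_comp, isLinear_of_isIso F e.inv, hβ'.1, (hF.iv_b α' hα').2, one_mul, one_mul]
  refine ⟨(γ, β, α.1), ⟨?_, ⟨hA, n, rfl⟩, ⟨hβb, hβpre⟩, α.2⟩, ?_⟩
  · show γ ≫ β ≫ α.1 = φ
    rw [← Category.assoc, hγβ, hψ]
  -- uniqueness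
  rintro ⟨γ₁, β₁, α₁⟩ ⟨hfac₁, hγ₁, ⟨hβ₁b, hβ₁pre⟩, hα₁⟩
  dsimp only at hfac₁ hγ₁ hβ₁b hβ₁pre hα₁
  obtain ⟨hγ₁eq, hγ₁b⟩ := IsFDistinguished.eq_app hFr hγ₁ hA
  -- `α₁ = α`
  have hα₁eq : α₁ = α.1 := by
    have hb : Base F α₁ = Base F φ := by
      rw [← hfac₁, base_comp, base_comp, show Base F γ₁ = 𝟙 _ from hγ₁b,
        show Base F β₁ = 𝟙 _ from hβ₁b, Category.id_comp, Category.id_comp]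
    have : (⟨α₁, hα₁⟩ : A' ⟶ B') = α :=
      (P.toBase F).map_injective (X := A') (Y := B') (hb.trans hαb.symm)
    exact congrArg Subtype.val this
  -- `γ₁ ; β₁ = ψ`
  have hψ₁ : γ₁ ≫ β₁ = ψ := by
    refine (hαpb A).1 (Subtype.ext (Prod.ext ?_ ?_))
    · show (γ₁ ≫ β₁) ≫ α.1 = ψ ≫ α.1
      rw [hψ, Category.assoc, ← hfac₁, hα₁eq]
    · show Base F (γ₁ ≫ β₁) = Base F ψ
      rw [base_comp, show Base F γ₁ = 𝟙 _ from hγ₁b, show Base F β₁ = 𝟙 _ from hβ₁b, hψb,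
        Category.id_comp]
  -- `γ₁ = γ`
  have hγ₁γ : γ₁ = γ := by
    have hd : degFr F γ₁ = n := by
      rw [hn, ← hψ₁, degFr_comp, hβ₁pre.1, mul_one]
    rw [hγ₁eq, hd]
  -- `β₁ = β`
  have hβ₁β : β₁ = β := by
    haveI := hPF.isTotallyEpimorphic.epi γ
    rw [← cancel_epi γ, hγβ, ← hγ₁γ, hψ₁]
  rw [hγ₁γ, hβ₁β, hα₁eq]

end PreFrobenioid

end Literature.AlgebraicGeometry.Frobenioids
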